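import Mathlib.NumberTheory.Chebyshev
import Mathlib.Analysis.Asymptotics.AsymptoticEquivalent
import Literature.NumberTheory.LFunctions.RHWave0PNTProofs
import HarnessLib

/-!
# [IUTchIV] Proposition 1.6 (The Prime Number Theorem) and Proposition 2.1 (Well-known Estimates)

Mochizuki, *Inter-universal Teichmüller theory IV: log-volume computations and set-theoretic
foundations*, RIMS manuscript (Apr. 2020; = Publ. RIMS **57** (2021) 627–723), §1 Proposition 1.6
(p. 16) and §2 Proposition 2.1 (p. 40). Both are elementary consequences of the prime number theorem,
which the tree PROVES (`Literature.NumberTheory.LFunctions.primeCounting_isEquivalent_holds`,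
`π(x) ~ x/log x`, and `Literature.NumberTheory.LFunctions.chebyshevTheta_isEquivalent`, `ϑ(x) ~ x`);
so every statement below is a THEOREM — no named fact is introduced. The constants are exactly the
printed ones (`4/3`, `2/3`, `ξ_prm ≥ 5`, `2·(θ_A + ξ_prm)`). The bibliographic key of the series carries
the D-0012 claim status, hence the tag form [claim: Mochizuki2012, status: disputed] on the statements
transcribed from [IUTchIV]; the mathematics here is classical and undisputed (Hadamard–de la Vallée
Poussin 1896).

**Prop. 1.6 as printed (p. 16).** "If `n` is a positive integer, then let us write `p_n` for the `n`-th
smallest prime number. [Thus, `p_1 = 2`, `p_2 = 3`, and so on.] Then there exists an integer `n_0` such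
that it holds that `n ≤ 4p_n/(3·log(p_n))` for all `n ≥ n_0`. In particular, there exists a positive real
number `η_prm` such that `Σ_{p ≤ η} 1 ≤ 4η/(3·log(η))` — where the sum ranges over the prime numbers
`p ≤ η` — for all positive real `η ≥ η_prm`."

**Prop. 2.1 as printed (p. 40).** "(i) (Linearization of Logarithms) We have `log(x) ≤ x` for all
`(ℝ ∋) x ≥ 1` [= Mathlib `Real.log_le_self`; not restated]. (ii) (The Prime Number Theorem) There exists a real number `ξ_prm ≥ 5` such that
`(2/3)·x ≤ θ(x) := Σ_{p ≤ x} log(p) ≤ (4/3)·x` — where the sum ranges over the prime numbers `p` such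
that `p ≤ x` — for all `(ℝ ∋) x ≥ ξ_prm`. In particular, if `A` is a finite set of prime numbers, and
we write `θ_A := Σ_{p ∈ A} log(p)` [where we take the sum to be `0` if `A = ∅`], then there exists a
prime number `p ∉ A` such that `p ≤ 2(θ_A + ξ_prm)`."

Also recorded (for [IUTchIV] Theorem 1.10, Step (viii), p. 30–31): the form in which Prop. 1.6 is
USED there, `log(x)·π(x) ≤ (4/3)·(x + η_prm)` "regardless of the size of" `x`
(`log_mul_primeCounting_le_of_isEtaPrm`).

Deliberately NOT here: anything about log-volumes; the constant `η_prm` is existential, exactly as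
printed (no numerical value is asserted).
-/

namespace Literature.IUT.LogVolume

open Real Filter Asymptotics Finset
open scoped Nat.Prime Chebyshev

/-! ## Proposition 1.6 -/

/-- `p_n`, "the `n`-th smallest prime number" (`p_1 = 2`, `p_2 = 3`, …), [IUTchIV] Prop. 1.6 (p. 16).
Indexing from `1` as printed: `nthPrime n = Nat.nth Nat.Prime (n - 1)`; the junk value `nthPrime 0 = 2`
is never used (all statements quantify over `n ≥ n_0 ≥ 1`). [claim: Mochizuki2012, status: disputed] -/
noncomputable def nthPrime (n : ℕ) : ℕ := Nat.nth Nat.Prime (n - 1)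

/-- `π(p_n) = n` for `n ≥ 1`. [folklore] -/
private theorem primeCounting_nthPrime {n : ℕ} (hn : 1 ≤ n) : π (nthPrime n) = n := by
  unfold nthPrime
  rw [Nat.primeCounting_eq_primeCounting'_succ, Nat.primeCounting', Nat.count_succ,
    ← Nat.primeCounting', Nat.primeCounting'_nth_eq]
  simp only [Nat.prime_nth_prime, if_true]
  omega

/-- `n + 1 ≤ p_n` (so `p_n → ∞`). [folklore] -/
private theorem succ_le_nthPrime (n : ℕ) : n + 1 ≤ nthPrime n := by
  unfold nthPrime
  have := Nat.add_two_le_nth_prime (n - 1)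
  omega

/-- The prime number theorem in the form: for `x ≥ X₀`, `π(x) ≤ (4/3)·x/log(x)` (from the tree's
`π(x) ~ x/log x`, with `ε = 1/3`). [folklore] -/
private theorem exists_primeCounting_le_four_thirds :
    ∃ X₀ : ℝ, 1 < X₀ ∧ ∀ x : ℝ, X₀ ≤ x → (π ⌊x⌋₊ : ℝ) ≤ 4 * x / (3 * Real.log x) := by
  have hPNT := Literature.NumberTheory.LFunctions.primeCounting_isEquivalent_holds
  unfold Literature.NumberTheory.LFunctions.primeCounting_isEquivalent at hPNT
  have hb := hPNT.isLittleO.bound (show (0 : ℝ) < 1 / 3 by norm_num)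
  rw [Filter.eventually_atTop] at hb
  obtain ⟨a, ha⟩ := hb
  refine ⟨max a 2, by
    have : (2 : ℝ) ≤ max a 2 := le_max_right _ _
    linarith, fun x hx => ?_⟩
  have hxa : a ≤ x := le_trans (le_max_left _ _) hx
  have hx2 : (2 : ℝ) ≤ x := le_trans (le_max_right _ _) hx
  have hlog : 0 < Real.log x := Real.log_pos (by linarith)
  have hq : 0 ≤ x / Real.log x := div_nonneg (by linarith) hlog.le
  have h := ha x hxa
  simp only [Pi.sub_apply, Real.norm_eq_abs] at h
  rw [abs_of_nonneg hq] at h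
  have h' : (π ⌊x⌋₊ : ℝ) - x / Real.log x ≤ 1 / 3 * (x / Real.log x) := le_trans (le_abs_self _) h
  have : (π ⌊x⌋₊ : ℝ) ≤ 4 / 3 * (x / Real.log x) := by linarith
  calc (π ⌊x⌋₊ : ℝ) ≤ 4 / 3 * (x / Real.log x) := this
    _ = 4 * x / (3 * Real.log x) := by field_simp

/-- **[IUTchIV] Proposition 1.6, first display (p. 16)**: "there exists an integer `n_0` such that
`n ≤ 4p_n/(3·log(p_n))` for all `n ≥ n_0`" — PROVED from the prime number theorem (printed proof:
"`lim n·log(p_n)/p_n = 1` … in particular … `log(p_n)/p_n ≤ (4/3)·(1/n)` for all `n ≥ n_0`").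
[claim: Mochizuki2012, status: disputed] -/
theorem exists_le_nthPrime_div_log :
    ∃ n₀ : ℕ, 1 ≤ n₀ ∧ ∀ n : ℕ, n₀ ≤ n →
      (n : ℝ) ≤ 4 * (nthPrime n : ℝ) / (3 * Real.log (nthPrime n)) := by
  obtain ⟨X₀, hX₀, hX⟩ := exists_primeCounting_le_four_thirds
  refine ⟨⌈X₀⌉₊ + 1, by omega, fun n hn => ?_⟩
  have hn1 : 1 ≤ n := by omega
  have hp : X₀ ≤ (nthPrime n : ℝ) := by
    have h1 := succ_le_nthPrime n
    have h2 : X₀ ≤ ⌈X₀⌉₊ := Nat.le_ceil _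
    have h3 : (⌈X₀⌉₊ : ℝ) + 1 ≤ n := by exact_mod_cast hn
    have h4 : (n : ℝ) + 1 ≤ nthPrime n := by exact_mod_cast h1
    linarith
  have := hX (nthPrime n) hp
  rwa [Nat.floor_natCast, primeCounting_nthPrime hn1] at this

/-- The property that makes `η_prm` "the positive real number of Proposition 1.6" ([IUTchIV] p. 16,
second display): `η_prm > 0` and `Σ_{p ≤ η} 1 ≤ 4η/(3·log(η))` for all real `η ≥ η_prm`.
(A predicate on `η_prm`; Theorem 1.10 is stated for any such `η_prm`.)
[claim: Mochizuki2012, status: disputed] -/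
def IsEtaPrm (η_prm : ℝ) : Prop :=
  0 < η_prm ∧ ∀ η : ℝ, η_prm ≤ η → (π ⌊η⌋₊ : ℝ) ≤ 4 * η / (3 * Real.log η)

/-- **[IUTchIV] Proposition 1.6, second display (p. 16)**: "there exists a positive real number
`η_prm` such that `Σ_{p ≤ η} 1 ≤ 4η/(3·log(η))` … for all positive real `η ≥ η_prm`" — PROVED
(here `Σ_{p ≤ η} 1 = π(⌊η⌋)`). [claim: Mochizuki2012, status: disputed] -/
theorem exists_isEtaPrm : ∃ η_prm : ℝ, IsEtaPrm η_prm := by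
  obtain ⟨X₀, hX₀, hX⟩ := exists_primeCounting_le_four_thirds
  exact ⟨X₀, by linarith, hX⟩

/-- "`Σ_{p ≤ η} 1` — where the sum ranges over the prime numbers `p ≤ η`" ([IUTchIV] Prop. 1.6, p. 16),
i.e. the number of primes `≤ η`, is `π(⌊η⌋)` (bookkeeping between the printed sum and Mathlib's
`Nat.primeCounting`). [claim: Mochizuki2012, status: disputed] -/
theorem card_primesLE_floor_eq (η : ℝ) : #(Nat.primesLE ⌊η⌋₊) = π ⌊η⌋₊ := by
  rw [Nat.primeCounting, Nat.primeCounting', Nat.count_eq_card_filter_range, Nat.primesLE,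
    Nat.primesBelow]

/-- **Prop. 1.6 in the form used in the proof of [IUTchIV] Theorem 1.10, Step (viii) (pp. 30–31)**:
for `η_prm` as in Prop. 1.6 and every real `x ≥ 0`, `log(x)·(Σ_{p ≤ x} 1) ≤ (4/3)·(x + η_prm)` — the
printed case distinction "if `x ≥ η_prm`" (`≤ (4/3)·x`) / "if `x < η_prm`" (`≤ log(η_prm)·Σ_{p ≤ η_prm} 1
≤ (4/3)·η_prm`), "i.e., regardless of the size of" `x`. [claim: Mochizuki2012, status: disputed] -/
theorem log_mul_primeCounting_le_of_isEtaPrm {η_prm : ℝ} (hη : IsEtaPrm η_prm) {x : ℝ}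
    (hx : 0 ≤ x) : Real.log x * (π ⌊x⌋₊ : ℝ) ≤ 4 / 3 * (x + η_prm) := by
  obtain ⟨hpos, hbound⟩ := hη
  -- a generic step: for `y ≥ η_prm`, `log(y)·π(y) ≤ (4/3)·y`
  have key : ∀ y : ℝ, η_prm ≤ y → Real.log y * (π ⌊y⌋₊ : ℝ) ≤ 4 / 3 * y := by
    intro y hy
    have hy0 : 0 < y := lt_of_lt_of_le hpos hy
    rcases le_or_gt y 1 with hy1 | hy1
    · -- `y ≤ 1`: no primes `≤ y`
      have : ⌊y⌋₊ ≤ 1 := by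
        have := Nat.floor_le_floor hy1
        simpa using this
      have h0 : π ⌊y⌋₊ = 0 := Nat.primeCounting_eq_zero_iff.mpr this
      rw [h0]; simp; linarith
    · have hlog : 0 < Real.log y := Real.log_pos hy1
      have hb := hbound y hy
      calc Real.log y * (π ⌊y⌋₊ : ℝ) ≤ Real.log y * (4 * y / (3 * Real.log y)) :=
            mul_le_mul_of_nonneg_left hb hlog.le
        _ = 4 / 3 * y := by field_simp
  rcases le_or_gt η_prm x with hle | hlt
  · have := key x hle
    linarith
  · -- `x < η_prm`: monotonicity of `log` and of `π`, then the bound at `η_prm`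
    have hk := key η_prm le_rfl
    rcases le_or_gt x 1 with hx1 | hx1
    · have : ⌊x⌋₊ ≤ 1 := by
        have := Nat.floor_le_floor hx1
        simpa using this
      have h0 : π ⌊x⌋₊ = 0 := Nat.primeCounting_eq_zero_iff.mpr this
      rw [h0]; simp; linarith
    · have hlogx : 0 ≤ Real.log x := (Real.log_pos hx1).le
      have hlogle : Real.log x ≤ Real.log η_prm := Real.log_le_log (by linarith) hlt.le
      have hpile : (π ⌊x⌋₊ : ℝ) ≤ π ⌊η_prm⌋₊ := by
        exact_mod_cast Nat.monotone_primeCounting (Nat.floor_le_floor hlt.le)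
      have hpi0 : (0 : ℝ) ≤ π ⌊η_prm⌋₊ := by positivity
      calc Real.log x * (π ⌊x⌋₊ : ℝ) ≤ Real.log x * π ⌊η_prm⌋₊ :=
            mul_le_mul_of_nonneg_left hpile hlogx
        _ ≤ Real.log η_prm * π ⌊η_prm⌋₊ := mul_le_mul_of_nonneg_right hlogle hpi0
        _ ≤ 4 / 3 * η_prm := hk
        _ ≤ 4 / 3 * (x + η_prm) := by linarith

/-! ## Proposition 2.1 -/

-- [IUTchIV] Proposition 2.1 (i) (Linearization of Logarithms, p. 40), "`log(x) ≤ x` for all `x ≥ 1`",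
-- is Mathlib's `Real.log_le_self` (for `x ≥ 0`) and, verbatim, the tree's already-landed
-- `Literature.NumberTheory.Transcendental.Waldschmidt1978.log_le_self_of_one_le`; not restated here.

/-- The property that makes `ξ_prm` "the real number of Proposition 2.1 (ii)" ([IUTchIV] p. 40):
`ξ_prm ≥ 5` and `(2/3)·x ≤ θ(x) ≤ (4/3)·x` for all real `x ≥ ξ_prm`, where `θ(x) = Σ_{p ≤ x} log(p)` is
Mathlib's `Chebyshev.theta`. [claim: Mochizuki2012, status: disputed] -/
def IsXiPrm (ξ_prm : ℝ) : Prop :=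
  5 ≤ ξ_prm ∧ ∀ x : ℝ, ξ_prm ≤ x → 2 / 3 * x ≤ θ x ∧ θ x ≤ 4 / 3 * x

/-- **[IUTchIV] Proposition 2.1 (ii), first part (p. 40)**: "There exists a real number `ξ_prm ≥ 5`
such that `(2/3)·x ≤ θ(x) ≤ (4/3)·x` … for all `x ≥ ξ_prm`" — PROVED from the tree's `ϑ(x) ~ x`
(`Literature.NumberTheory.LFunctions.chebyshevTheta_isEquivalent`, `ε = 1/3`).
[claim: Mochizuki2012, status: disputed] -/
theorem exists_isXiPrm : ∃ ξ_prm : ℝ, IsXiPrm ξ_prm := by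
  have hθ := Literature.NumberTheory.LFunctions.chebyshevTheta_isEquivalent
  have hb := hθ.isLittleO.bound (show (0 : ℝ) < 1 / 3 by norm_num)
  rw [Filter.eventually_atTop] at hb
  obtain ⟨a, ha⟩ := hb
  refine ⟨max a 5, le_max_right _ _, fun x hx => ?_⟩
  have hxa : a ≤ x := le_trans (le_max_left _ _) hx
  have hx0 : (0 : ℝ) ≤ x := le_trans (by norm_num) (le_trans (le_max_right a 5) hx)
  have h := ha x hxa
  simp only [Pi.sub_apply, Real.norm_eq_abs, abs_of_nonneg hx0] at h
  obtain ⟨h1, h2⟩ := abs_le.mp h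
  constructor <;> linarith

/-- `θ_A := Σ_{p ∈ A} log(p)` for a finite set `A` of prime numbers ("where we take the sum to be `0`
if `A = ∅`"), [IUTchIV] Prop. 2.1 (ii) (p. 40). [claim: Mochizuki2012, status: disputed] -/
noncomputable def thetaSet (A : Finset ℕ) : ℝ := ∑ p ∈ A, Real.log p

/-- "[where we take the sum to be `0` if `A = ∅`]" ([IUTchIV] Prop. 2.1 (ii), p. 40): `θ_∅ = 0`.
[claim: Mochizuki2012, status: disputed] -/
theorem thetaSet_empty : thetaSet ∅ = 0 := by simp [thetaSet]

/-- `θ_A ≥ 0`. [folklore] -/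
private theorem thetaSet_nonneg (A : Finset ℕ) : 0 ≤ thetaSet A :=
  Finset.sum_nonneg fun p _ => Real.log_natCast_nonneg p

/-- If every prime `≤ x` lies in `A`, then `θ(x) ≤ θ_A`. [folklore] -/
private theorem theta_le_thetaSet_of_subset {A : Finset ℕ} {x : ℝ}
    (h : ∀ p : ℕ, p.Prime → (p : ℝ) ≤ x → p ∈ A) : θ x ≤ thetaSet A := by
  rw [Chebyshev.theta_eq_sum_primesLE, thetaSet]
  refine Finset.sum_le_sum_of_subset_of_nonneg (fun p hp => ?_)
    (fun p _ _ => Real.log_natCast_nonneg p)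
  rw [Nat.mem_primesLE] at hp
  refine h p hp.2 ?_
  rcases lt_or_ge x 0 with hx | hx
  · have : ⌊x⌋₊ = 0 := Nat.floor_of_nonpos hx.le
    rw [this] at hp
    exact absurd hp.2 (by have := hp.1; interval_cases p; decide)
  · exact le_trans (by exact_mod_cast hp.1) (Nat.floor_le hx)

/-- **[IUTchIV] Proposition 2.1 (ii), "in particular" (p. 40)**: for `ξ_prm` as above and `A` a finite
set of prime numbers, "there exists a prime number `p ∉ A` such that `p ≤ 2(θ_A + ξ_prm)`" — PROVED:
at `x := 2(θ_A + ξ_prm) ≥ ξ_prm` one has `θ(x) ≥ (2/3)x = (4/3)(θ_A + ξ_prm) > θ_A`, so not every prime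
`≤ x` lies in `A`. (The hypothesis that `A` consists of primes is not even needed.)
[claim: Mochizuki2012, status: disputed] -/
theorem exists_prime_not_mem_le_of_isXiPrm {ξ_prm : ℝ} (hξ : IsXiPrm ξ_prm) (A : Finset ℕ) :
    ∃ p : ℕ, p.Prime ∧ p ∉ A ∧ (p : ℝ) ≤ 2 * (thetaSet A + ξ_prm) := by
  obtain ⟨h5, hθ⟩ := hξ
  have hA := thetaSet_nonneg A
  set x : ℝ := 2 * (thetaSet A + ξ_prm) with hxdef
  have hx : ξ_prm ≤ x := by rw [hxdef]; linarith
  have hlow := (hθ x hx).1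
  by_contra hcon
  push Not at hcon
  have hall : ∀ p : ℕ, p.Prime → (p : ℝ) ≤ x → p ∈ A := by
    intro p hp hpx
    by_contra hpA
    exact absurd (hcon p hp hpA) (not_lt.mpr hpx)
  have := theta_le_thetaSet_of_subset hall
  have : 2 / 3 * x ≤ thetaSet A := le_trans hlow this
  rw [hxdef] at this
  linarith

end Literature.IUT.LogVolume
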